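import Summits.QuantumFields.YangMills.Theorems.PencilRigidityCurvatureKernelBoundTensorRegularityPlaneWave
import Literature.MathematicalPhysics.QuantumLattice.WightmanTubeLaplace

/-!
# Three-slot regularity, Part 4: uniform norm control on the flattened frequency space

Support file for stub `stub_threeSlotRegularity` (C) of reshape 4 of
`Cruxes/TemperedCurvatureMoments/Lines/Sketch.lean` (crux stmt-QuantumFields-17721, line `Sketch`).
The geometric input of the Fourier-decay argument on `(ℝ⁴)³`, flattened by `flattenCLE 3 3` to the inner
product space `ℝ¹²`:

* `exists_norm_le_mul_abs_inner_of_top_le_span` — a finite SPANNING family `S` controls the norm,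
  `‖ξ‖ ≤ K maxᵥ |⟪ξ, w⟫|` (`w ∈ S`; injectivity of `ξ ↦ (⟪ξ, w⟫)_w` + antilipschitz in finite dimension);
* `exists_uniform_norm_le_mul_abs_inner` — ONE constant `K` for all spanning sub-families of a fixed finite
  set `W` (finitely many sub-families);
* `pow_mul_le_of_decay` — bookkeeping: decay of order `N ≤ P + k` along the controlling generator and
  growth of order `P` give decay `(1 + ‖ξ‖)^{-k}`;
* `inner_flattenCLE`, `inner_flattenCLE_single`, `inner_flattenCLE_const`, `norm_apply_le_norm_flattenCLE` —
  the flattening is an isometry onto `ℝ¹²` slot by slot;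
* `norm_le_two_of_latticeFrame` — the lattice directions `±e_μ`, `(±e_μ ± e_ν)/√2` have norm `≤ 2`;
* `exists_nonempty_slot_of_top_le_span` — a slot-direction assignment whose slot vectors and the four
  diagonal translations span `(ℝ⁴)³` has a non-empty slot;
* `exists_uniform_normControl` — for EVERY assignment `D` of lattice directions to the three slots with
  the spanning property, every frequency `a` is controlled, with ONE constant, by some slot pairing
  `|⟪a_k, t⟫|` (`t ∈ D k`) or some total-frequency pairing `|⟪Σᵢ aᵢ, e_μ⟫|` (the menu of lattice
  directions is finite, so the flattened generators range over sub-families of one finite set).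
[folklore]
-/

noncomputable section

namespace Summit.QuantumFields.YangMills.Theorems.TemperedCurvatureMoments.Sketch

namespace ThreeSlotRegularity

open scoped BigOperators RealInnerProductSpace
open Set Metric
open Literature.MathematicalPhysics.QuantumLattice Literature.Analysis.FunctionSpaces

/-! ## Spanning families control the norm, uniformly over sub-families of a finite set -/

section NormControl

variable {V : Type*} [NormedAddCommGroup V] [InnerProductSpace ℝ V] [FiniteDimensional ℝ V]

/-- **A finite spanning family controls the norm**: if `⊤ ≤ span S` for a non-empty finite `S`, there
is `K ≥ 0` with `‖ξ‖ ≤ K |⟪ξ, w⟫|` for some `w ∈ S` depending on `ξ` (the linear map `ξ ↦ (⟪ξ, w⟫)_{w ∈ S}`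
is injective, hence antilipschitz in finite dimension). [folklore] -/
theorem exists_norm_le_mul_abs_inner_of_top_le_span (S : Finset V) (hS : S.Nonempty)
    (hspan : ⊤ ≤ Submodule.span ℝ (S : Set V)) :
    ∃ K : ℝ, 0 ≤ K ∧ ∀ ξ : V, ∃ w ∈ S, ‖ξ‖ ≤ K * |⟪ξ, w⟫| := by
  classical
  let T : V →ₗ[ℝ] (S → ℝ) :=
    { toFun := fun ξ w => ⟪ξ, (w : V)⟫
      map_add' := fun ξ ζ => funext fun w => inner_add_left _ _ _
      map_smul' := fun c ξ => funext fun w => by simp [real_inner_smul_left] }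
  have hT : ∀ ξ w, T ξ w = ⟪ξ, (w : V)⟫ := fun ξ w => rfl
  have hker : LinearMap.ker T = ⊥ := by
    refine LinearMap.ker_eq_bot'.2 fun ξ hξ => ?_
    have h0 : ∀ w ∈ S, ⟪ξ, w⟫ = 0 := fun w hw => by
      have := congrFun hξ ⟨w, hw⟩
      rwa [hT] at this
    -- `S ⊆ (ℝ ∙ ξ)ᗮ`, hence `⊤ ≤ span S ≤ (ℝ ∙ ξ)ᗮ` and `ξ ⊥ ξ`
    have hle : Submodule.span ℝ (S : Set V) ≤ (ℝ ∙ ξ)ᗮ := by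
      refine Submodule.span_le.2 fun w hw => ?_
      exact (Submodule.mem_orthogonal_singleton_iff_inner_right).2 (h0 w hw)
    have hξ' : ξ ∈ (ℝ ∙ ξ)ᗮ := hle (hspan Submodule.mem_top)
    exact inner_self_eq_zero.1 ((Submodule.mem_orthogonal_singleton_iff_inner_right).1 hξ')
  obtain ⟨K, -, hK⟩ := T.exists_antilipschitzWith hker
  refine ⟨K, K.coe_nonneg, fun ξ => ?_⟩
  obtain ⟨w, hw, hmax⟩ := Finset.exists_max_image S (fun w => |⟪ξ, w⟫|) hS
  refine ⟨w, hw, ?_⟩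
  have h1 : ‖ξ‖ ≤ K * ‖T ξ‖ := by
    have := hK.le_mul_dist ξ 0
    simpa [dist_eq_norm] using this
  have h2 : ‖T ξ‖ ≤ |⟪ξ, w⟫| :=
    (pi_norm_le_iff_of_nonneg (abs_nonneg _)).2 fun w' => by
      rw [hT, Real.norm_eq_abs]
      exact hmax w' w'.2
  exact h1.trans (mul_le_mul_of_nonneg_left h2 K.coe_nonneg)

/-- **One constant for all spanning sub-families of a finite set.** For a finite `W ⊆ V` there is
`K ≥ 0` such that every non-empty `S ⊆ W` with `⊤ ≤ span S` controls the norm with constant `K`: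
`‖ξ‖ ≤ K |⟪ξ, w⟫|` for some `w ∈ S` (take the largest of the finitely many constants). [folklore] -/
theorem exists_uniform_norm_le_mul_abs_inner (W : Finset V) :
    ∃ K : ℝ, 0 ≤ K ∧ ∀ S : Finset V, S ⊆ W → S.Nonempty → ⊤ ≤ Submodule.span ℝ (S : Set V) →
      ∀ ξ : V, ∃ w ∈ S, ‖ξ‖ ≤ K * |⟪ξ, w⟫| := by
  classical
  have hpt : ∀ S : Finset V, ∃ K : ℝ, 0 ≤ K ∧ (S.Nonempty → ⊤ ≤ Submodule.span ℝ (S : Set V) →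
      ∀ ξ : V, ∃ w ∈ S, ‖ξ‖ ≤ K * |⟪ξ, w⟫|) := by
    intro S
    by_cases h : S.Nonempty ∧ ⊤ ≤ Submodule.span ℝ (S : Set V)
    · obtain ⟨K, hK0, hK⟩ := exists_norm_le_mul_abs_inner_of_top_le_span S h.1 h.2
      exact ⟨K, hK0, fun _ _ => hK⟩
    · exact ⟨0, le_rfl, fun h1 h2 => absurd ⟨h1, h2⟩ h⟩
  choose K hK0 hK using hpt
  refine ⟨∑ S ∈ W.powerset, K S, Finset.sum_nonneg fun S _ => hK0 S, fun S hSW hS hspan ξ => ?_⟩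
  obtain ⟨w, hw, hle⟩ := hK S hS hspan ξ
  refine ⟨w, hw, hle.trans (mul_le_mul_of_nonneg_right ?_ (abs_nonneg _))⟩
  exact Finset.single_le_sum (f := K) (fun S _ => hK0 S) (Finset.mem_powerset.2 hSW)

/-- **Decay bookkeeping.** If `p ≥ 0` controls `s ≥ 1` (`s ≤ 1 + K p`) and
`pᴺ g ≤ 3ᴺ D s^P` for all `N ≤ P + k` (including `N = 0`), then `sᵏ g ≤ (3 (1 + K))^{P+k} D`
(take the larger of `1` and `p`). [folklore] -/
theorem pow_mul_le_of_decay {K p g D s : ℝ} {P k : ℕ} (hK : 0 ≤ K) (hg : 0 ≤ g)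
    (hD : 0 ≤ D) (hs1 : 1 ≤ s) (hsp : s ≤ 1 + K * p)
    (h : ∀ N ≤ P + k, p ^ N * g ≤ 3 ^ N * (D * s ^ P)) :
    s ^ k * g ≤ (3 * (1 + K)) ^ (P + k) * D := by
  set m := max 1 p with hm
  have hm1 : 1 ≤ m := le_max_left _ _
  have hpm : p ≤ m := le_max_right _ _
  have hsm : s ≤ (1 + K) * m := by nlinarith
  have hmg : m ^ (P + k) * g ≤ 3 ^ (P + k) * (D * s ^ P) := by
    rcases le_total p 1 with h1 | h2
    · rw [hm, max_eq_left h1, one_pow, one_mul]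
      have h0 := h 0 (Nat.zero_le _)
      rw [pow_zero, one_mul, pow_zero, one_mul] at h0
      exact h0.trans (le_mul_of_one_le_left (by positivity) (one_le_pow₀ (by norm_num)))
    · rw [hm, max_eq_right h2]
      exact h _ le_rfl
  have hs0 : 0 ≤ s := by linarith
  have hmain : s ^ (P + k) * g ≤ (3 * (1 + K)) ^ (P + k) * D * s ^ P := by
    calc s ^ (P + k) * g ≤ ((1 + K) * m) ^ (P + k) * g := by gcongr
      _ = (1 + K) ^ (P + k) * (m ^ (P + k) * g) := by rw [mul_pow]; ring
      _ ≤ (1 + K) ^ (P + k) * (3 ^ (P + k) * (D * s ^ P)) := by gcongr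
      _ = (3 * (1 + K)) ^ (P + k) * D * s ^ P := by rw [mul_pow]; ring
  have hspos : 0 < s ^ P := by positivity
  rw [pow_add, show s ^ P * s ^ k * g = s ^ P * (s ^ k * g) by ring,
    show (3 * (1 + K)) ^ (P + k) * D * s ^ P = s ^ P * ((3 * (1 + K)) ^ (P + k) * D) by ring] at hmain
  exact le_of_mul_le_mul_left hmain hspos

end NormControl

/-! ## The flattening `(ℝ⁴)ⁿ ≃ ℝ⁴ⁿ`, slot by slot -/

section Flatten

variable {n : ℕ}

/-- Inner products of flattened configurations: `⟪Φx, Φy⟫ = Σᵢ ⟪xᵢ, yᵢ⟫`. [folklore] -/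
theorem inner_flattenCLE (x y : Fin n → EuclideanSpace ℝ (Fin 4)) :
    ⟪flattenCLE 3 n x, flattenCLE 3 n y⟫ = ∑ i, ⟪x i, y i⟫ := by
  simp [PiLp.inner_apply, flattenCLE_apply, Fintype.sum_prod_type]

/-- Pairing with a flattened slot vector: `⟪Φx, Φ(0,…,t,…,0)⟫ = ⟪x_k, t⟫`. [folklore] -/
theorem inner_flattenCLE_single (x : Fin n → EuclideanSpace ℝ (Fin 4)) (k : Fin n) (t : EuclideanSpace ℝ (Fin 4)) :
    ⟪flattenCLE 3 n x, flattenCLE 3 n (Pi.single k t)⟫ = ⟪x k, t⟫ := by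
  rw [inner_flattenCLE, Finset.sum_eq_single k]
  · rw [Pi.single_eq_same]
  · intro i _ hi
    rw [Pi.single_eq_of_ne hi, inner_zero_right]
  · exact fun h => absurd (Finset.mem_univ k) h

/-- Pairing with a flattened diagonal translation: `⟪Φx, Φ(u,…,u)⟫ = ⟪Σᵢ xᵢ, u⟫`. [folklore] -/
theorem inner_flattenCLE_const (x : Fin n → EuclideanSpace ℝ (Fin 4)) (u : EuclideanSpace ℝ (Fin 4)) :
    ⟪flattenCLE 3 n x, flattenCLE 3 n (fun _ : Fin n => u)⟫ = ⟪∑ i, x i, u⟫ := by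
  rw [inner_flattenCLE, sum_inner]

/-- Each slot is bounded by the flattened norm: `‖xᵢ‖ ≤ ‖Φx‖`. [folklore] -/
theorem norm_apply_le_norm_flattenCLE (x : Fin n → EuclideanSpace ℝ (Fin 4)) (i : Fin n) :
    ‖x i‖ ≤ ‖flattenCLE 3 n x‖ := by
  have h1 : ‖x i‖ ^ 2 ≤ ‖flattenCLE 3 n x‖ ^ 2 := by
    rw [← real_inner_self_eq_norm_sq, ← real_inner_self_eq_norm_sq (flattenCLE 3 n x), inner_flattenCLE]
    exact Finset.single_le_sum (f := fun j => ⟪x j, x j⟫) (fun j _ => real_inner_self_nonneg) (Finset.mem_univ i)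
  exact (pow_le_pow_iff_left₀ (norm_nonneg _) (norm_nonneg _) two_ne_zero).1 h1

end Flatten

/-! ## The lattice directions and the slot-direction assignments -/

section Lattice

/-- The lattice directions of the oriented frames — axis directions `±e_μ` and diagonal directions
`(±e_μ ± e_ν)/√2` — have norm at most `2`. [folklore] -/
theorem norm_le_two_of_latticeFrame {t : EuclideanSpace ℝ (Fin 4)}
    (ht : ∃ n v : EuclideanSpace ℝ (Fin 4),
      ((∃ (μ ν : Fin 4) (s s' : ℝ), μ ≠ ν ∧ (s = 1 ∨ s = -1) ∧ (s' = 1 ∨ s' = -1) ∧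
          n = s • (EuclideanSpace.single μ (1 : ℝ) : EuclideanSpace ℝ (Fin 4)) ∧
          v = s' • (EuclideanSpace.single ν (1 : ℝ) : EuclideanSpace ℝ (Fin 4))) ∨
        (∃ (μ ν : Fin 4) (s s' : ℝ), μ ≠ ν ∧ (s = 1 ∨ s = -1) ∧ (s' = 1 ∨ s' = -1) ∧
          n = (Real.sqrt 2)⁻¹ • (s • (EuclideanSpace.single μ (1 : ℝ) : EuclideanSpace ℝ (Fin 4)) +
            s' • (EuclideanSpace.single ν (1 : ℝ) : EuclideanSpace ℝ (Fin 4))) ∧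
          v = (Real.sqrt 2)⁻¹ • (s • (EuclideanSpace.single μ (1 : ℝ) : EuclideanSpace ℝ (Fin 4)) -
            s' • (EuclideanSpace.single ν (1 : ℝ) : EuclideanSpace ℝ (Fin 4))))) ∧
      (t = n ∨ t = v)) :
    ‖t‖ ≤ 2 := by
  have hsingle : ∀ (μ : Fin 4) (s : ℝ), (s = 1 ∨ s = -1) →
      ‖s • (EuclideanSpace.single μ (1 : ℝ) : EuclideanSpace ℝ (Fin 4))‖ = 1 := by
    intro μ s hs
    rcases hs with rfl | rfl <;> simp
  have hsqrt : ‖((Real.sqrt 2)⁻¹ : ℝ)‖ ≤ 1 := by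
    rw [Real.norm_eq_abs, abs_of_pos (inv_pos.2 (Real.sqrt_pos.2 (by norm_num : (0 : ℝ) < 2)))]
    exact inv_le_one_of_one_le₀ (Real.one_le_sqrt.2 (by norm_num))
  obtain ⟨n, v, hnv, ht⟩ := ht
  rcases hnv with ⟨μ, ν, s, s', -, hs, hs', rfl, rfl⟩ | ⟨μ, ν, s, s', -, hs, hs', rfl, rfl⟩
  · rcases ht with rfl | rfl
    · rw [hsingle μ s hs]; norm_num
    · rw [hsingle ν s' hs']; norm_num
  · rcases ht with rfl | rfl
    · rw [norm_smul]
      refine (mul_le_mul hsqrt (norm_add_le _ _) (norm_nonneg _) zero_le_one).trans ?_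
      rw [hsingle μ s hs, hsingle ν s' hs']; norm_num
    · rw [norm_smul]
      refine (mul_le_mul hsqrt (norm_sub_le _ _) (norm_nonneg _) zero_le_one).trans ?_
      rw [hsingle μ s hs, hsingle ν s' hs']; norm_num

/-- **A spanning slot-direction assignment has a non-empty slot**: if the slot vectors `(0,…,t,…,0)`,
`t ∈ D k`, together with the four diagonal translations `(e_μ, e_μ, e_μ)` span `(ℝ⁴)³`, some `D k` is
non-empty (four vectors do not span a `12`-dimensional space). [folklore] -/
theorem exists_nonempty_slot_of_top_le_span (D : Fin 3 → Finset (EuclideanSpace ℝ (Fin 4)))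
    (hspan : ⊤ ≤ Submodule.span ℝ
      ((⋃ k : Fin 3, (fun t : EuclideanSpace ℝ (Fin 4) => (Pi.single k t : Fin 3 → EuclideanSpace ℝ (Fin 4))) ''
          (D k : Set (EuclideanSpace ℝ (Fin 4)))) ∪
        Set.range (fun μ : Fin 4 => fun _ : Fin 3 => (EuclideanSpace.single μ (1 : ℝ) : EuclideanSpace ℝ (Fin 4))))) :
    ∃ k, (D k).Nonempty := by
  classical
  by_contra hall
  have hempty : ∀ k, D k = ∅ := fun k => Finset.not_nonempty_iff_eq_empty.1 fun h => hall ⟨k, h⟩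
  set diag : Fin 4 → (Fin 3 → EuclideanSpace ℝ (Fin 4)) :=
    fun μ => fun _ : Fin 3 => (EuclideanSpace.single μ (1 : ℝ) : EuclideanSpace ℝ (Fin 4)) with hdiag
  have hG : ((⋃ k : Fin 3, (fun t : EuclideanSpace ℝ (Fin 4) => (Pi.single k t : Fin 3 → EuclideanSpace ℝ (Fin 4))) ''
          (D k : Set (EuclideanSpace ℝ (Fin 4)))) ∪ Set.range diag) =
      ((Finset.univ.image diag : Finset (Fin 3 → EuclideanSpace ℝ (Fin 4))) : Set (Fin 3 → EuclideanSpace ℝ (Fin 4))) := by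
    rw [Finset.coe_image, Finset.coe_univ, Set.image_univ]
    have h1 : (⋃ k : Fin 3, (fun t : EuclideanSpace ℝ (Fin 4) => (Pi.single k t : Fin 3 → EuclideanSpace ℝ (Fin 4))) ''
        (D k : Set (EuclideanSpace ℝ (Fin 4)))) = ∅ := by
      simp [hempty]
    rw [h1, Set.empty_union]
  rw [hG] at hspan
  have h1 : Module.finrank ℝ (Submodule.span ℝ ((Finset.univ.image diag :
      Finset (Fin 3 → EuclideanSpace ℝ (Fin 4))) : Set (Fin 3 → EuclideanSpace ℝ (Fin 4)))) ≤ 4 :=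
    (finrank_span_finset_le_card _).trans (Finset.card_image_le.trans (by simp))
  have h2 : Module.finrank ℝ (⊤ : Submodule ℝ (Fin 3 → EuclideanSpace ℝ (Fin 4))) = 12 := by
    rw [finrank_top, Module.finrank_pi_fintype]
    simp only [finrank_euclideanSpace, Fintype.card_fin, Finset.sum_const, Finset.card_univ, smul_eq_mul]
  have h3 := Submodule.finrank_mono hspan
  omega

/-- **Uniform norm control for the admissible slot-direction assignments.** There is ONE `K ≥ 0` such
that for every assignment `D` of lattice directions (time or partner direction of an oriented axis or
diagonal frame) to the three slots whose slot vectors together with the four diagonal translations span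
`(ℝ⁴)³`, every frequency `a ∈ (ℝ⁴)³` is controlled by one of the generators: `‖Φa‖ ≤ K |⟪a_k, t⟫|` for
some `t ∈ D k`, or `‖Φa‖ ≤ K |⟪Σᵢ aᵢ, e_μ⟫|` for some `μ` (`Φ = flattenCLE 3 3`; the flattened generators of
`D` form a spanning sub-family of the finite set of all flattened lattice generators). [folklore] -/
theorem exists_uniform_normControl :
    ∃ K : ℝ, 0 ≤ K ∧ ∀ (D : Fin 3 → Finset (EuclideanSpace ℝ (Fin 4))),
      (∀ k, ∀ t ∈ D k, (∃ n v : EuclideanSpace ℝ (Fin 4),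
        ((∃ (μ ν : Fin 4) (s s' : ℝ), μ ≠ ν ∧ (s = 1 ∨ s = -1) ∧ (s' = 1 ∨ s' = -1) ∧
            n = s • (EuclideanSpace.single μ (1 : ℝ) : EuclideanSpace ℝ (Fin 4)) ∧
            v = s' • (EuclideanSpace.single ν (1 : ℝ) : EuclideanSpace ℝ (Fin 4))) ∨
          (∃ (μ ν : Fin 4) (s s' : ℝ), μ ≠ ν ∧ (s = 1 ∨ s = -1) ∧ (s' = 1 ∨ s' = -1) ∧
            n = (Real.sqrt 2)⁻¹ • (s • (EuclideanSpace.single μ (1 : ℝ) : EuclideanSpace ℝ (Fin 4)) +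
              s' • (EuclideanSpace.single ν (1 : ℝ) : EuclideanSpace ℝ (Fin 4))) ∧
            v = (Real.sqrt 2)⁻¹ • (s • (EuclideanSpace.single μ (1 : ℝ) : EuclideanSpace ℝ (Fin 4)) -
              s' • (EuclideanSpace.single ν (1 : ℝ) : EuclideanSpace ℝ (Fin 4))))) ∧ (t = n ∨ t = v))) →
      (⊤ ≤ Submodule.span ℝ
        ((⋃ k : Fin 3, (fun t : EuclideanSpace ℝ (Fin 4) => (Pi.single k t : Fin 3 → EuclideanSpace ℝ (Fin 4))) ''
            (D k : Set (EuclideanSpace ℝ (Fin 4)))) ∪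
          Set.range (fun μ : Fin 4 => fun _ : Fin 3 => (EuclideanSpace.single μ (1 : ℝ) : EuclideanSpace ℝ (Fin 4))))) →
      ∀ a : Fin 3 → EuclideanSpace ℝ (Fin 4),
        (∃ k, ∃ t ∈ D k, ‖flattenCLE 3 3 a‖ ≤ K * |⟪a k, t⟫|) ∨
        (∃ μ : Fin 4, ‖flattenCLE 3 3 a‖ ≤ K * |⟪∑ i, a i, (EuclideanSpace.single μ (1 : ℝ) : EuclideanSpace ℝ (Fin 4))⟫|) := by
  classical
  set Φ : (Fin 3 → EuclideanSpace ℝ (Fin 4)) ≃L[ℝ] EuclideanSpace ℝ (Fin 3 × Fin 4) := flattenCLE 3 3 with hΦ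
  set e : Fin 4 → EuclideanSpace ℝ (Fin 4) := fun μ => EuclideanSpace.single μ (1 : ℝ) with he
  set sg : Bool → ℝ := fun b => if b then 1 else -1 with hsg
  have hsg' : ∀ s : ℝ, (s = 1 ∨ s = -1) → ∃ b : Bool, s = sg b := by
    rintro s (rfl | rfl)
    exacts [⟨true, by simp [hsg]⟩, ⟨false, by simp [hsg]⟩]
  -- the finite menu of lattice directions
  set cand : Fin 4 × Fin 4 × Bool × Bool × Fin 3 → EuclideanSpace ℝ (Fin 4) := fun p =>
    if p.2.2.2.2 = 0 then sg p.2.2.1 • e p.1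
    else if p.2.2.2.2 = 1 then (Real.sqrt 2)⁻¹ • (sg p.2.2.1 • e p.1 + sg p.2.2.2.1 • e p.2.1)
    else (Real.sqrt 2)⁻¹ • (sg p.2.2.1 • e p.1 - sg p.2.2.2.1 • e p.2.1) with hcand
  set menu : Finset (EuclideanSpace ℝ (Fin 4)) := Finset.univ.image cand with hmenu
  have hmem_menu : ∀ t : EuclideanSpace ℝ (Fin 4), (∃ n v : EuclideanSpace ℝ (Fin 4),
      ((∃ (μ ν : Fin 4) (s s' : ℝ), μ ≠ ν ∧ (s = 1 ∨ s = -1) ∧ (s' = 1 ∨ s' = -1) ∧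
          n = s • e μ ∧ v = s' • e ν) ∨
        (∃ (μ ν : Fin 4) (s s' : ℝ), μ ≠ ν ∧ (s = 1 ∨ s = -1) ∧ (s' = 1 ∨ s' = -1) ∧
          n = (Real.sqrt 2)⁻¹ • (s • e μ + s' • e ν) ∧ v = (Real.sqrt 2)⁻¹ • (s • e μ - s' • e ν))) ∧
      (t = n ∨ t = v)) → t ∈ menu := by
    rintro t ⟨n, v, hnv, ht⟩
    rw [hmenu, Finset.mem_image]
    rcases hnv with ⟨μ, ν, s, s', -, hs, hs', rfl, rfl⟩ | ⟨μ, ν, s, s', -, hs, hs', rfl, rfl⟩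
    · obtain ⟨b, rfl⟩ := hsg' s hs
      obtain ⟨b', rfl⟩ := hsg' s' hs'
      rcases ht with rfl | rfl
      · exact ⟨(μ, ν, b, b', 0), Finset.mem_univ _, by simp [hcand]⟩
      · exact ⟨(ν, μ, b', b, 0), Finset.mem_univ _, by simp [hcand]⟩
    · obtain ⟨b, rfl⟩ := hsg' s hs
      obtain ⟨b', rfl⟩ := hsg' s' hs'
      rcases ht with rfl | rfl
      · exact ⟨(μ, ν, b, b', 1), Finset.mem_univ _, by simp [hcand]⟩
      · exact ⟨(μ, ν, b, b', 2), Finset.mem_univ _, by simp [hcand]⟩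
  -- the finite set of all flattened lattice generators
  set W : Finset (EuclideanSpace ℝ (Fin 3 × Fin 4)) :=
    (Finset.univ ×ˢ menu).image (fun q : Fin 3 × EuclideanSpace ℝ (Fin 4) => Φ (Pi.single q.1 q.2)) ∪
      Finset.univ.image (fun μ : Fin 4 => Φ (fun _ : Fin 3 => e μ)) with hW
  obtain ⟨K, hK0, hK⟩ := exists_uniform_norm_le_mul_abs_inner W
  refine ⟨K, hK0, fun D hD hspan a => ?_⟩
  -- the flattened generators of `D`
  set SD : Finset (EuclideanSpace ℝ (Fin 3 × Fin 4)) :=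
    (Finset.univ.biUnion fun k : Fin 3 => (D k).image fun t => Φ (Pi.single k t)) ∪
      Finset.univ.image (fun μ : Fin 4 => Φ (fun _ : Fin 3 => e μ)) with hSD
  have hSDW : SD ⊆ W := by
    rw [hSD, hW]
    refine Finset.union_subset_union ?_ le_rfl
    intro w hw
    obtain ⟨k, -, hk⟩ := Finset.mem_biUnion.1 hw
    obtain ⟨t, ht, rfl⟩ := Finset.mem_image.1 hk
    exact Finset.mem_image.2 ⟨(k, t), Finset.mem_product.2 ⟨Finset.mem_univ _, hmem_menu t (hD k t ht)⟩, rfl⟩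
  have hSDne : SD.Nonempty :=
    ⟨Φ (fun _ : Fin 3 => e 0), by
      rw [hSD]
      exact Finset.mem_union_right _ (Finset.mem_image.2 ⟨0, Finset.mem_univ _, rfl⟩)⟩
  -- `⊤ ≤ span SD`: transport the spanning hypothesis along `Φ`
  have hspanSD : ⊤ ≤ Submodule.span ℝ (SD : Set (EuclideanSpace ℝ (Fin 3 × Fin 4))) := by
    set G : Set (Fin 3 → EuclideanSpace ℝ (Fin 4)) :=
      (⋃ k : Fin 3, (fun t : EuclideanSpace ℝ (Fin 4) => (Pi.single k t : Fin 3 → EuclideanSpace ℝ (Fin 4))) ''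
          (D k : Set (EuclideanSpace ℝ (Fin 4)))) ∪ Set.range (fun μ : Fin 4 => fun _ : Fin 3 => e μ) with hG
    have himg : (Φ.toLinearEquiv : (Fin 3 → EuclideanSpace ℝ (Fin 4)) →ₗ[ℝ] EuclideanSpace ℝ (Fin 3 × Fin 4)) '' G ⊆
        (SD : Set (EuclideanSpace ℝ (Fin 3 × Fin 4))) := by
      rintro _ ⟨g, hg, rfl⟩
      change Φ g ∈ (SD : Set (EuclideanSpace ℝ (Fin 3 × Fin 4)))
      rw [Finset.mem_coe, hSD, Finset.mem_union]
      rcases hg with hg | ⟨μ, rfl⟩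
      · obtain ⟨k, hk⟩ := Set.mem_iUnion.1 hg
        obtain ⟨t, ht, rfl⟩ := hk
        exact Or.inl (Finset.mem_biUnion.2 ⟨k, Finset.mem_univ _, Finset.mem_image.2 ⟨t, ht, rfl⟩⟩)
      · exact Or.inr (Finset.mem_image.2 ⟨μ, Finset.mem_univ _, rfl⟩)
    have h1 : (Submodule.span ℝ G).map
        (Φ.toLinearEquiv : (Fin 3 → EuclideanSpace ℝ (Fin 4)) →ₗ[ℝ] EuclideanSpace ℝ (Fin 3 × Fin 4)) ≤
        Submodule.span ℝ (SD : Set (EuclideanSpace ℝ (Fin 3 × Fin 4))) := by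
      rw [Submodule.map_span]
      exact Submodule.span_mono himg
    have h2 : (⊤ : Submodule ℝ (Fin 3 → EuclideanSpace ℝ (Fin 4))).map
        (Φ.toLinearEquiv : (Fin 3 → EuclideanSpace ℝ (Fin 4)) →ₗ[ℝ] EuclideanSpace ℝ (Fin 3 × Fin 4)) = ⊤ := by
      rw [Submodule.map_top, LinearEquiv.range]
    calc (⊤ : Submodule ℝ (EuclideanSpace ℝ (Fin 3 × Fin 4))) = _ := h2.symm
      _ ≤ (Submodule.span ℝ G).map _ := Submodule.map_mono hspan
      _ ≤ _ := h1
  -- the controlling generator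
  obtain ⟨w, hw, hle⟩ := hK SD hSDW hSDne hspanSD (Φ a)
  rw [hSD, Finset.mem_union] at hw
  rcases hw with hw | hw
  · obtain ⟨k, -, hk⟩ := Finset.mem_biUnion.1 hw
    obtain ⟨t, ht, rfl⟩ := Finset.mem_image.1 hk
    refine Or.inl ⟨k, t, ht, ?_⟩
    rwa [hΦ, inner_flattenCLE_single] at hle
  · obtain ⟨μ, -, rfl⟩ := Finset.mem_image.1 hw
    refine Or.inr ⟨μ, ?_⟩
    rwa [hΦ, inner_flattenCLE_const] at hle

end Lattice

end ThreeSlotRegularity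

end Summit.QuantumFields.YangMills.Theorems.TemperedCurvatureMoments.Sketch

end
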